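import Mathlib
import Summits.ValiantsHypothesis.ValiantsHypothesis.Theorems.GrenetZeonHessianRankCodimTwoPlaneCriterion
import Summits.ValiantsHypothesis.ValiantsHypothesis.Theorems.GrenetZeonHessianRankCodimTwo
import Summits.ValiantsHypothesis.ValiantsHypothesis.Theorems.GrenetZeonPolySizeQPAlgebraHomogeneousCorner
import Summits.ValiantsHypothesis.ValiantsHypothesis.Theorems.GrenetZeonPolySizeQPAlgebraSumsOfDeterminants
import Literature.Computability.AlgebraicComplexity.MignonRessayreBound
import Literature.Computability.AlgebraicComplexity.StandardFamiliesProofs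
import HarnessLib

/-!
# Crux `GrenetZeon.PolySizeQPAlgebra` (stmt-ValiantsHypothesis-8064), line `vbp-slice-dealg` —
# the SPACE CRITERION and the conditional SEMISIMPLE RUNGS `(n, s)` of the `c = 1` box

Status of the `c = 1` box of the piece (`m ≤ n + 1`, `s ≤ 2 · 2^(log₂ n)`): `s ≤ 2` is empty
(`…SliceTwo`, `…HomogeneousCorner`), the diagonal corner is exact (`DiagonalBound`), and at the
degree floor `m = n` every witness is a sum of `≤ s` homogeneous LINEAR determinants over local
Frobenius algebras (`…HomogeneousLocalForm`).  The next rung is `(n, 3)`; its semisimple type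
`R = ℂ³` reads `per_n = α₁ det L₁ + α₂ det L₂ + α₃ det L₃` with `Lᵢ` linear `n × n`.

The only engine in the tree is the Hessian: at a common zero `p` of the `det Lᵢ` the Hessian of the
right-hand side has rank `≤ 2n` per summand (`rank_hess0_det_le`), so one needs a common zero of
`per_n, det L₁, …, det L_{s-1}` — a set cut out by `s` polynomials — at which `rank Hess per_n > 2sn`.
The crux `HessianRankCodimTwo` (stmt-8061, PROVED) supplies such points on sets cut out by TWO
polynomials (`per_n` and one `g`), from a GOOD PLANE (three independent matrices on whose span the
half-rank locus is avoided) through the cone criterion `exists_common_zero_not_subset_cone` of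
`…PlaneCriterion.lean`, which is already stated for spans of ANY dimension `c` and ANY homogeneous
equations.  This file draws the general consequence:

* `spaceCriterion` — **space criterion.** If `c` linearly independent matrices span a space on
  which every non-zero zero of `per_n` has `rank Hess per_n > t` (a GOOD `c`-SPACE WITH THRESHOLD
  `t`), then every set `Z(per_n) ∩ Z(G)` with `#G + 1 < c` that is non-empty contains a point with
  `rank Hess per_n > t` (`planeCriterion` is `c = 3`, `t = ⌊n²/2⌋`, `#G = 1`).
* `rank_hess0_transl_sum_dets_le` — at a point where every `det Aᵢ` with `αᵢ ≠ 0` vanishes, the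
  Hessian of `Σ_{i<s} αᵢ det Aᵢ` (`Aᵢ` affine `m × m`) has rank `≤ s · 2m`.
* `perPoly_ne_sum_dets_of_goodSpace` — **the conditional semisimple rung.** A good `c`-space with
  threshold `t ≥ s · 2m`, `s < c`, excludes `per_n = Σ_{i<s} αᵢ det Aᵢ` for affine `m × m`
  matrices `Aᵢ` whose determinants have a common zero (only `s - 1` of the determinants are put in
  `G`: the last one vanishes at the point found because `per_n` does).
* `perPoly_ne_sum_linear_dets_of_goodSpace` — for LINEAR (homogeneous) `Aᵢ` the origin is the
  common zero, so a good `(s+1)`-space with threshold `s · 2m` excludes `per_n = Σ_{i<s} αᵢ det Lᵢ`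
  outright; `not_repr_pi_of_goodSpace` — equivalently NO `(n, s)`-representation of `per_n` over the
  split semisimple algebra `ℂ^s` (homogenization `exists_homogeneous_repr_of_isHomogeneous` is not
  needed: `eq_sum_dets_of_repr_pi` and the linear parts, via `homogeneousComponent_det_fin`).
* `perPoly_ne_sum_three_linear_dets_of_goodFourSpace` — the `(n, 3)` semisimple rung ⟸ a good
  `4`-space with threshold `6n`; `perPoly_ne_sum_linear_dets_all_large` — the all-large-`n` form for
  every fixed `s` ⟸ good `(s+1)`-spaces with threshold `2sn` for all large `n`.
* SANITY (`s = 2`, unconditional, BY NAME from the landed crux): `goodPlanes_all_large` is a good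
  `3`-space with threshold `⌊n²/2⌋`, so `perPoly_ne_sum_two_dets_all_large`: for large `n`, `per_n`
  is not `α det A + β det B` for affine `m × m` matrices with a common zero of `det A, det B` and
  `8m ≤ n²` — the common-zero branch of `stub_splitCase` (stmt-8062), re-derived through the
  criterion.

What remains for the `(n, 3)` rung is therefore ONE geometric input: a good `4`-space with LINEAR
threshold (`6n` for `ℂ³`; `8n` covers `ℂ × ℂ[ε]/ε²` with the dual jet count `…DualJet`), i.e.
`dim {p ∈ Z(per_n) : rank Hess per_n(p) ≤ 8n} ≤ n² - 4`.  (Exact numerics recorded in the hand's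
census show the local type `ℂ[ε]/ε³` needs the same `c = 4`: at a corank-one zero of `det M₀` on
`Z(per_n)` the Hessian of the second-jet form has full rank `n²` unless `tr(adj M₀ · M₁)` vanishes
too.)  HONEST FRAMING: reductions and one re-derived known case; no stub of the line is closed, the
piece and VP ≠ VNP are not moved.

References: Hartshorne, *Algebraic Geometry*, I Thm. 7.2 / Ex. 2.10 (projective dimension theorem
for cones) [Hartshorne1977]; T. Mignon, N. Ressayre, IMRN 2004:79, §2 (Hessian of `det` at a
singular point) [MignonRessayre2004].
-/

noncomputable section

open MvPolynomial Matrix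
open Literature.Computability.AlgebraicComplexity

-- single-conjunct layout `Summits/ValiantsHypothesis/ValiantsHypothesis`: duplicated namespace by design
set_option linter.dupNamespace false

namespace Summit.ValiantsHypothesis.ValiantsHypothesis.Theorems.GrenetZeonPolySizeQPAlgebra

open Summit.ValiantsHypothesis.ValiantsHypothesis.Theorems.GrenetZeon.HessianRankCodimTwo
  (exists_common_zero_not_subset_cone eval_det_submatrix_hessMatrix
    isHomogeneous_det_submatrix_hessMatrix)
open Summit.ValiantsHypothesis.ValiantsHypothesis.Cruxes.TwoDimCoefficients.DimTwoCases.SplitCase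
  (rank_hess0_transl_det_le rank_smul_hess0_le)

/-! ### The space criterion -/

/-- **Space criterion** (general form of the plane criterion of crux `HessianRankCodimTwo`).  If
`w₁, …, w_c` are linearly independent `n × n` matrices such that at every non-zero point of their
span lying on `Z(per_n)` the Hessian of `per_n` has rank `> t`, then for every finite set `G` of
polynomials with `#G + 1 < c`, every non-empty `Z(per_n) ∩ Z(G)` contains a point where the Hessian
of `per_n` has rank `> t`.  Proof: the cone criterion with `T = {per_n} ∪ {(t+1)-minors of the
polynomial Hessian matrix}` (homogeneous) and the `< c` equations `{per_n} ∪ G`.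
[cite: Hartshorne1977, I Thm. 7.2, Ex. 2.10] -/
theorem spaceCriterion {n c t : ℕ}
    (hW : ∃ w : Fin c → (Fin n × Fin n → ℂ), LinearIndependent ℂ w ∧
      ∀ a : Fin c → ℂ, a ≠ 0 → eval (∑ i, a i • w i) (perPoly (Fin n) ℂ) = 0 →
        t < (hess0 (transl (∑ i, a i • w i) (perPoly (Fin n) ℂ))).rank)
    (G : Finset (MvPolynomial (Fin n × Fin n) ℂ)) (hG : G.card + 1 < c)
    (hne : ∃ p : Fin n × Fin n → ℂ, eval p (perPoly (Fin n) ℂ) = 0 ∧ ∀ g ∈ G, eval p g = 0) :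
    ∃ p : Fin n × Fin n → ℂ, eval p (perPoly (Fin n) ℂ) = 0 ∧ (∀ g ∈ G, eval p g = 0) ∧
      t < (hess0 (transl p (perPoly (Fin n) ℂ))).rank := by
  classical
  obtain ⟨w, hw, hgood⟩ := hW
  obtain ⟨p₀, hp₀per, hp₀G⟩ := hne
  set per : MvPolynomial (Fin n × Fin n) ℂ := perPoly (Fin n) ℂ with hper
  set H : Matrix (Fin n × Fin n) (Fin n × Fin n) (MvPolynomial (Fin n × Fin n) ℂ) :=
    Matrix.of fun s u => pderiv s (pderiv u per) with hH
  -- rank `> t` iff some `(t+1)`-minor of the Hessian is non-zero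
  have hrank : ∀ p : Fin n × Fin n → ℂ,
      t < (hess0 (transl p per)).rank ↔
        ∃ (r cc : Fin (t + 1) → Fin n × Fin n), eval p ((H.submatrix r cc).det) ≠ 0 := by
    intro p
    have h1 : t < (hess0 (transl p per)).rank ↔ ¬ (hess0 (transl p per)).rank ≤ t := by omega
    rw [h1, Literature.LinearAlgebra.Matrix.rank_le_iff_det_submatrix_eq_zero]
    push Not
    simp only [hH, eval_det_submatrix_hessMatrix]
  -- the cone equations `T = {per} ∪ {minors}`
  set T : Set (MvPolynomial (Fin n × Fin n) ℂ) :=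
    insert per (Set.range fun rc : (Fin (t + 1) → Fin n × Fin n) × (Fin (t + 1) → Fin n × Fin n) =>
      (H.submatrix rc.1 rc.2).det) with hT
  have hThom : ∀ q ∈ T, ∃ d, q.IsHomogeneous d := by
    intro q hq
    rcases Set.mem_insert_iff.1 hq with rfl | ⟨rc, rfl⟩
    · exact ⟨_, perPoly_isHomogeneous⟩
    · exact ⟨_, isHomogeneous_det_submatrix_hessMatrix perPoly_isHomogeneous rc.1 rc.2⟩
  -- goodness: on `span(w) ∖ 0`, some member of `T` does not vanish
  have hgood' : ∀ x ∈ Submodule.span ℂ (Set.range w), x ≠ 0 → ∃ q ∈ T, eval x q ≠ 0 := by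
    intro x hx hx0
    obtain ⟨a, rfl⟩ := (Submodule.mem_span_range_iff_exists_fun ℂ).1 hx
    have ha : a ≠ 0 := by rintro rfl; exact hx0 (by simp)
    by_cases hpx : eval (∑ i, a i • w i) per = 0
    · obtain ⟨r, cc, hrc⟩ := (hrank _).1 (hgood a ha hpx)
      exact ⟨_, Set.mem_insert_of_mem _ ⟨(r, cc), rfl⟩, hrc⟩
    · exact ⟨per, Set.mem_insert _ _, hpx⟩
  -- the `< c` equations `{per} ∪ G`
  have hcard : (insert per G).card < c := lt_of_le_of_lt (Finset.card_insert_le _ _) hG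
  obtain ⟨p, hpG, q, hqT, hpq⟩ := exists_common_zero_not_subset_cone T hThom hw hgood'
    (insert per G) hcard
    ⟨p₀, by
      intro g hg
      rcases Finset.mem_insert.1 hg with rfl | hg
      · exact hp₀per
      · exact hp₀G g hg⟩
  have hpper : eval p per = 0 := hpG per (Finset.mem_insert_self _ _)
  have hpG' : ∀ g ∈ G, eval p g = 0 := fun g hg => hpG g (Finset.mem_insert_of_mem hg)
  refine ⟨p, hpper, hpG', ?_⟩
  rcases Set.mem_insert_iff.1 hqT with rfl | ⟨rc, rfl⟩
  · exact absurd hpper hpq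
  · exact (hrank p).2 ⟨rc.1, rc.2, hpq⟩

/-- Monotonicity of goodness in the threshold: a good `c`-space with threshold `t` is one with any
threshold `t' ≤ t`. [folklore] -/
theorem goodSpace_mono {n c t t' : ℕ} (htt : t' ≤ t)
    (hW : ∃ w : Fin c → (Fin n × Fin n → ℂ), LinearIndependent ℂ w ∧
      ∀ a : Fin c → ℂ, a ≠ 0 → eval (∑ i, a i • w i) (perPoly (Fin n) ℂ) = 0 →
        t < (hess0 (transl (∑ i, a i • w i) (perPoly (Fin n) ℂ))).rank) :
    ∃ w : Fin c → (Fin n × Fin n → ℂ), LinearIndependent ℂ w ∧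
      ∀ a : Fin c → ℂ, a ≠ 0 → eval (∑ i, a i • w i) (perPoly (Fin n) ℂ) = 0 →
        t' < (hess0 (transl (∑ i, a i • w i) (perPoly (Fin n) ℂ))).rank := by
  obtain ⟨w, hw, h⟩ := hW
  exact ⟨w, hw, fun a ha h0 => lt_of_le_of_lt htt (h a ha h0)⟩

/-! ### Hessian rank of a sum of determinants at a common zero -/

/-- At a point `p` where every determinant `det Aᵢ` carrying a non-zero weight vanishes, the Hessian
of `Σ_{i<s} αᵢ det Aᵢ` (`Aᵢ` affine `m × m`) has rank `≤ s · 2m`: each summand contributes `≤ 2m`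
(`rank_hess0_det_le` after translation) and the rank is subadditive.
[cite: MignonRessayre2004, §2] -/
theorem rank_hess0_transl_sum_dets_le {n m s : ℕ}
    (A : Fin s → Matrix (Fin m) (Fin m) (MvPolynomial (Fin n × Fin n) ℂ))
    (hA : ∀ i j k, (A i j k).totalDegree ≤ 1) (α : Fin s → ℂ) (p : Fin n × Fin n → ℂ)
    (hp : ∀ i, α i ≠ 0 → eval p (A i).det = 0) :
    (hess0 (transl p (∑ i, C (α i) * (A i).det))).rank ≤ s * (2 * m) := by
  have hsplit : hess0 (transl p (∑ i, C (α i) * (A i).det)) =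
      ∑ i, α i • hess0 (transl p (A i).det) := by
    rw [map_sum, map_sum]
    refine Finset.sum_congr rfl fun i _ => ?_
    rw [map_mul, transl_C, hess0_C_mul]
  rw [hsplit]
  refine (rank_sum_le _ _).trans ?_
  calc ∑ i, (α i • hess0 (transl p (A i).det)).rank ≤ ∑ _i : Fin s, 2 * m :=
        Finset.sum_le_sum fun i _ => rank_smul_hess0_le (α i) _ _ fun hαi =>
          rank_hess0_transl_det_le (A i) (hA i) p (hp i hαi)
    _ = s * (2 * m) := by rw [Finset.sum_const, Finset.card_univ, Fintype.card_fin, smul_eq_mul]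

/-- Evaluating a weighted sum of determinants. [folklore] -/
theorem eval_sum_C_mul_det {n m s : ℕ} (A : Fin s → Matrix (Fin m) (Fin m) (MvPolynomial (Fin n × Fin n) ℂ))
    (α : Fin s → ℂ) (p : Fin n × Fin n → ℂ) :
    eval p (∑ i, C (α i) * (A i).det) = ∑ i, α i * eval p (A i).det := by
  rw [map_sum]
  exact Finset.sum_congr rfl fun i _ => by rw [map_mul, eval_C]

/-! ### The conditional semisimple rung -/

/-- **Conditional semisimple rung.** Let a good `c`-space with threshold `t` exist for `per_n`, let
`s < c` and `s · 2m ≤ t`.  Then `per_n ≠ Σ_{i<s} αᵢ det Aᵢ` for affine `m × m` matrices `Aᵢ` whose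
determinants have a common zero.  Proof: the space criterion with `G = {det Aᵢ : i ≠ last}`
(`#G + 1 ≤ s < c`) gives a common zero `p` of `per_n` and these `det Aᵢ` with `rank Hess per_n(p) > t`;
at `p` also `α_last det A_last` vanishes (it equals `per_n(p)` minus the others), so the Hessian of the
right-hand side has rank `≤ s · 2m ≤ t` (`rank_hess0_transl_sum_dets_le`) — contradiction.
[cite: MignonRessayre2004, §2] -/
theorem perPoly_ne_sum_dets_of_goodSpace {n c t m s : ℕ}
    (hW : ∃ w : Fin c → (Fin n × Fin n → ℂ), LinearIndependent ℂ w ∧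
      ∀ a : Fin c → ℂ, a ≠ 0 → eval (∑ i, a i • w i) (perPoly (Fin n) ℂ) = 0 →
        t < (hess0 (transl (∑ i, a i • w i) (perPoly (Fin n) ℂ))).rank)
    (hsc : s < c) (ht : s * (2 * m) ≤ t)
    (A : Fin s → Matrix (Fin m) (Fin m) (MvPolynomial (Fin n × Fin n) ℂ))
    (hA : ∀ i j k, (A i j k).totalDegree ≤ 1) (α : Fin s → ℂ)
    (h0 : ∃ p₀ : Fin n × Fin n → ℂ, ∀ i, eval p₀ (A i).det = 0) :
    perPoly (Fin n) ℂ ≠ ∑ i, C (α i) * (A i).det := by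
  classical
  intro hper
  obtain ⟨p₀, hp₀⟩ := h0
  cases s with
  | zero =>
    rw [Fintype.sum_empty] at hper
    exact perPoly_ne_zero (Fin n) ℂ hper
  | succ k =>
    set i₁ : Fin (k + 1) := Fin.last k with hi₁
    set G : Finset (MvPolynomial (Fin n × Fin n) ℂ) :=
      (Finset.univ.erase i₁).image fun i => (A i).det with hG
    have hGcard : G.card + 1 < c := by
      have h1 : G.card ≤ (Finset.univ.erase i₁).card := Finset.card_image_le
      rw [Finset.card_erase_of_mem (Finset.mem_univ _), Finset.card_univ, Fintype.card_fin] at h1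
      omega
    have hne : ∃ p : Fin n × Fin n → ℂ, eval p (perPoly (Fin n) ℂ) = 0 ∧ ∀ g ∈ G, eval p g = 0 := by
      refine ⟨p₀, ?_, ?_⟩
      · rw [hper, eval_sum_C_mul_det]
        exact Finset.sum_eq_zero fun i _ => by rw [hp₀ i, mul_zero]
      · intro g hg
        obtain ⟨i, -, rfl⟩ := Finset.mem_image.1 hg
        exact hp₀ i
    obtain ⟨p, hpper, hpG, hprank⟩ := spaceCriterion hW G hGcard hne
    have hpi : ∀ i, i ≠ i₁ → eval p (A i).det = 0 := fun i hi =>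
      hpG _ (Finset.mem_image.2 ⟨i, Finset.mem_erase.2 ⟨hi, Finset.mem_univ _⟩, rfl⟩)
    have hp : ∀ i, α i ≠ 0 → eval p (A i).det = 0 := by
      intro i hαi
      by_cases hi : i = i₁
      · have h := hpper
        rw [hper, eval_sum_C_mul_det, Finset.sum_eq_single i₁
          (fun j _ hj => by rw [hpi j hj, mul_zero]) (fun h => absurd (Finset.mem_univ _) h)] at h
        rw [hi]
        exact (mul_eq_zero.1 h).resolve_left (hi ▸ hαi)
      · exact hpi i hi
    have hle := rank_hess0_transl_sum_dets_le A hA α p hp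
    rw [hper] at hprank
    omega

/-- **Linear summands: the origin is the common zero.** A good `c`-space with threshold `t`,
`s < c`, `s · 2m ≤ t`, `1 ≤ m`, excludes `per_n = Σ_{i<s} αᵢ det Lᵢ` for `m × m` matrices `Lᵢ` of
LINEAR forms. [cite: MignonRessayre2004, §2] -/
theorem perPoly_ne_sum_linear_dets_of_goodSpace {n c t m s : ℕ}
    (hW : ∃ w : Fin c → (Fin n × Fin n → ℂ), LinearIndependent ℂ w ∧
      ∀ a : Fin c → ℂ, a ≠ 0 → eval (∑ i, a i • w i) (perPoly (Fin n) ℂ) = 0 →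
        t < (hess0 (transl (∑ i, a i • w i) (perPoly (Fin n) ℂ))).rank)
    (hsc : s < c) (ht : s * (2 * m) ≤ t) (hm : 1 ≤ m)
    (L : Fin s → Matrix (Fin m) (Fin m) (MvPolynomial (Fin n × Fin n) ℂ))
    (hL : ∀ i j k, (L i j k).IsHomogeneous 1) (α : Fin s → ℂ) :
    perPoly (Fin n) ℂ ≠ ∑ i, C (α i) * (L i).det :=
  perPoly_ne_sum_dets_of_goodSpace hW hsc ht L
    (fun i j k => totalDegree_le_one_of_isHomogeneous_one (hL i j k)) α
    ⟨0, fun i => by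
      rw [MvPolynomial.eval_zero]
      exact constantCoeff_det_eq_zero_of_isHomogeneous_one hm (L i) (hL i)⟩

/-- **The `(n, 3)` semisimple rung from a good `4`-space with threshold `6n`.** If four linearly
independent `n × n` matrices span a space on which every non-zero zero of `per_n` has
`rank Hess per_n > 6n`, then `per_n ≠ α₁ det L₁ + α₂ det L₂ + α₃ det L₃` for `n × n` matrices `Lᵢ`
of linear forms (`n ≥ 1`) — the type `R = ℂ³` of the point `(m, s) = (n, 3)` of the `c = 1` box.
[cite: MignonRessayre2004, §2] -/
theorem perPoly_ne_sum_three_linear_dets_of_goodFourSpace {n : ℕ} (hn : 1 ≤ n)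
    (hW : ∃ w : Fin 4 → (Fin n × Fin n → ℂ), LinearIndependent ℂ w ∧
      ∀ a : Fin 4 → ℂ, a ≠ 0 → eval (∑ i, a i • w i) (perPoly (Fin n) ℂ) = 0 →
        6 * n < (hess0 (transl (∑ i, a i • w i) (perPoly (Fin n) ℂ))).rank)
    (L : Fin 3 → Matrix (Fin n) (Fin n) (MvPolynomial (Fin n × Fin n) ℂ))
    (hL : ∀ i j k, (L i j k).IsHomogeneous 1) (α : Fin 3 → ℂ) :
    perPoly (Fin n) ℂ ≠ ∑ i, C (α i) * (L i).det :=
  perPoly_ne_sum_linear_dets_of_goodSpace hW (by norm_num) (by omega) hn L hL α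

/-- **All large `n`, every fixed `s`.** Good `(s+1)`-spaces with threshold `2sn` for all large `n`
exclude, for all large `n`, `per_n = Σ_{i<s} αᵢ det Lᵢ` with `Lᵢ` linear `n × n` — the semisimple
type `ℂ^s` of the point `(n, s)` of the `c = 1` box. [cite: MignonRessayre2004, §2] -/
theorem perPoly_ne_sum_linear_dets_all_large {s : ℕ}
    (hW : ∃ n₀ : ℕ, ∀ n ≥ n₀, ∃ w : Fin (s + 1) → (Fin n × Fin n → ℂ), LinearIndependent ℂ w ∧
      ∀ a : Fin (s + 1) → ℂ, a ≠ 0 → eval (∑ i, a i • w i) (perPoly (Fin n) ℂ) = 0 →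
        2 * s * n < (hess0 (transl (∑ i, a i • w i) (perPoly (Fin n) ℂ))).rank) :
    ∃ n₀ : ℕ, ∀ n ≥ n₀, ∀ (L : Fin s → Matrix (Fin n) (Fin n) (MvPolynomial (Fin n × Fin n) ℂ))
      (α : Fin s → ℂ), (∀ i j k, (L i j k).IsHomogeneous 1) →
        perPoly (Fin n) ℂ ≠ ∑ i, C (α i) * (L i).det := by
  obtain ⟨n₀, h⟩ := hW
  refine ⟨max n₀ 1, fun n hn L α hL => ?_⟩
  exact perPoly_ne_sum_linear_dets_of_goodSpace (h n (le_of_max_le_left hn)) (Nat.lt_succ_self s)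
    (by ring_nf; exact le_rfl) (le_of_max_le_right hn) L hL α

/-! ### No representation over the split semisimple algebra `ℂ^s` -/

/-- The component matrices of a matrix of linear forms over `ℂ^s` are matrices of linear forms.
[folklore] -/
theorem isHomogeneous_one_map_evalRingHom {n m s : ℕ}
    (A : Matrix (Fin m) (Fin m) (MvPolynomial (Fin n × Fin n) (Fin s → ℂ)))
    (hA : ∀ j k, (A j k).IsHomogeneous 1) (i : Fin s) (j k : Fin m) :
    (((MvPolynomial.map (Pi.evalRingHom (fun _ => ℂ) i)).mapMatrix A) j k).IsHomogeneous 1 := by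
  rw [RingHom.mapMatrix_apply, Matrix.map_apply]
  exact (hA j k).map _

/-- **No `(m, s)`-representation of `per_n` over `ℂ^s` with LINEAR entries, given a good
`(s+1)`-space** (threshold `≥ s · 2m`, `1 ≤ m`): by `eq_sum_dets_of_repr_pi` such a representation
is `per_n = Σ_i λ(e_i) det A^{(i)}` with linear component matrices. [cite: MignonRessayre2004, §2] -/
theorem not_linear_repr_pi_of_goodSpace {n c t m s : ℕ}
    (hW : ∃ w : Fin c → (Fin n × Fin n → ℂ), LinearIndependent ℂ w ∧
      ∀ a : Fin c → ℂ, a ≠ 0 → eval (∑ i, a i • w i) (perPoly (Fin n) ℂ) = 0 →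
        t < (hess0 (transl (∑ i, a i • w i) (perPoly (Fin n) ℂ))).rank)
    (hsc : s < c) (ht : s * (2 * m) ≤ t) (hm : 1 ≤ m)
    (l : (Fin s → ℂ) →ₗ[ℂ] ℂ) (A : Matrix (Fin m) (Fin m) (MvPolynomial (Fin n × Fin n) (Fin s → ℂ)))
    (hA : ∀ j k, (A j k).IsHomogeneous 1) :
    ¬ ∀ d : (Fin n × Fin n) →₀ ℕ, l (coeff d A.det) = coeff d (perPoly (Fin n) ℂ) := by
  intro hf
  exact perPoly_ne_sum_linear_dets_of_goodSpace hW hsc ht hm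
    (fun i => (MvPolynomial.map (Pi.evalRingHom (fun _ => ℂ) i)).mapMatrix A)
    (fun i j k => isHomogeneous_one_map_evalRingHom A hA i j k) (fun i => l (Pi.single i 1))
    (eq_sum_dets_of_repr_pi l A hf)

/-- **No `(n, s)`-representation of `per_n` over `ℂ^s` at the degree floor, given a good
`(s+1)`-space with threshold `2sn`** (`n ≥ 1`): affine entries are first replaced by their linear
parts (`homogeneousComponent_det_fin`: the degree-`n` coefficients of `det A` only see linear parts,
and `per_n` has no other coefficients), then `not_linear_repr_pi_of_goodSpace`.
[cite: MignonRessayre2004, §2] -/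
theorem not_repr_pi_of_goodSpace {n s : ℕ} (hn : 1 ≤ n)
    (hW : ∃ w : Fin (s + 1) → (Fin n × Fin n → ℂ), LinearIndependent ℂ w ∧
      ∀ a : Fin (s + 1) → ℂ, a ≠ 0 → eval (∑ i, a i • w i) (perPoly (Fin n) ℂ) = 0 →
        2 * s * n < (hess0 (transl (∑ i, a i • w i) (perPoly (Fin n) ℂ))).rank)
    (l : (Fin s → ℂ) →ₗ[ℂ] ℂ) (A : Matrix (Fin n) (Fin n) (MvPolynomial (Fin n × Fin n) (Fin s → ℂ)))
    (hA : ∀ j k, (A j k).totalDegree ≤ 1) :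
    ¬ ∀ d : (Fin n × Fin n) →₀ ℕ, l (coeff d A.det) = coeff d (perPoly (Fin n) ℂ) := by
  intro hf
  have hper : (perPoly (Fin n) ℂ).IsHomogeneous n := by
    simpa only [Fintype.card_fin] using (perPoly_isHomogeneous (n := Fin n) (k := ℂ))
  have hf' : ∀ d : (Fin n × Fin n) →₀ ℕ,
      l (coeff d (A.map (homogeneousComponent 1)).det) = coeff d (perPoly (Fin n) ℂ) := by
    intro d
    rw [← homogeneousComponent_det_fin A hA, coeff_homogeneousComponent]
    split_ifs with hd
    · exact hf d
    · rw [map_zero, hper.coeff_eq_zero hd]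
  exact not_linear_repr_pi_of_goodSpace hW (Nat.lt_succ_self s) (by ring_nf; exact le_rfl) hn l
    (A.map (homogeneousComponent 1)) (isHomogeneous_map_homogeneousComponent_one A) hf'

/-! ### Sanity: `s = 2` from the landed good planes (common-zero branch of the split case) -/

/-- The landed good planes (`goodPlanes_all_large`, crux `HessianRankCodimTwo`) are good `3`-spaces
with threshold `⌊n²/2⌋` in the sense of this file. [folklore] -/
theorem goodThreeSpace_all_large :
    ∃ n₀ : ℕ, ∀ n ≥ n₀, ∃ w : Fin 3 → (Fin n × Fin n → ℂ), LinearIndependent ℂ w ∧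
      ∀ a : Fin 3 → ℂ, a ≠ 0 → eval (∑ i, a i • w i) (perPoly (Fin n) ℂ) = 0 →
        n ^ 2 / 2 < (hess0 (transl (∑ i, a i • w i) (perPoly (Fin n) ℂ))).rank := by
  obtain ⟨n₀, h⟩ :=
    Summit.ValiantsHypothesis.ValiantsHypothesis.Theorems.GrenetZeonHessianRankCodimTwo.goodPlanes_all_large
  refine ⟨n₀, fun n hn => ?_⟩
  obtain ⟨w, hw, hgood⟩ := h n hn
  refine ⟨w, hw, fun a ha h0 => ?_⟩
  have := hgood a ha h0
  omega

/-- **`s = 2`, unconditionally (sanity re-derivation).** For all large `n`: `per_n ≠ α det A + β det B`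
for affine `m × m` matrices `A, B` whose determinants have a common zero, whenever `8m ≤ n²` — the
common-zero branch of `stub_splitCase` (crux `TwoDimCoefficients`, stmt-8062), obtained here from
`goodPlanes_all_large` through `perPoly_ne_sum_dets_of_goodSpace` with `c = 3`, `t = ⌊n²/2⌋`.
[cite: MignonRessayre2004, §2] -/
theorem perPoly_ne_sum_two_dets_all_large :
    ∃ n₀ : ℕ, ∀ n ≥ n₀, ∀ m : ℕ, 8 * m ≤ n ^ 2 →
      ∀ (A : Fin 2 → Matrix (Fin m) (Fin m) (MvPolynomial (Fin n × Fin n) ℂ)) (α : Fin 2 → ℂ),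
        (∀ i j k, (A i j k).totalDegree ≤ 1) →
          (∃ p₀ : Fin n × Fin n → ℂ, ∀ i, eval p₀ (A i).det = 0) →
            perPoly (Fin n) ℂ ≠ ∑ i, C (α i) * (A i).det := by
  obtain ⟨n₀, h⟩ := goodThreeSpace_all_large
  refine ⟨n₀, fun n hn m hm A α hA h0 => ?_⟩
  exact perPoly_ne_sum_dets_of_goodSpace (h n hn) (by norm_num) (by omega) A hA α h0

end Summit.ValiantsHypothesis.ValiantsHypothesis.Theorems.GrenetZeonPolySizeQPAlgebra

end
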